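import Summits.ValiantsHypothesis.ValiantsHypothesis.Theorems.LacunarySymmetroidMatrixDescartesPivotIndexGraded

/-!
# `MatrixDescartes` census — pivot column: THE DEFINITE-PIVOT GRADED LAW AT EVERY SIZE; the four-letter column with `J ⪯ 0`
# at `n = 3` is `≤ 14`

HONEST FRAMING.  Cell `pub-symmetroid`, seat `val-sym-mdr-p2` (gen 26); helper file `--supports` the crux
`Theses.LacunarySymmetroid.MatrixDescartes` (OPEN), NO closure claim.  Companion of `…PivotIndexGraded` (the index-graded Descartes bound):
when the pivot letter is NEGATIVE SEMIDEFINITE, `J = −W Wᵀ`, its positive part is absent from the Gram form and the odd levels are indexed by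
multisets of the `K` PSD letters only.
* **`negSemidef_pivot_graded`**: `Z₊ ≤ 2 · ∑_{j odd, j ≤ min r m} C(K + m − j − 1, K − 1)` (`W` real `m × r`, `K ≥ 1`); at `m = 2` this is the
  tree's `2K` law (`Pivot.DefinitePivot.pivotTwo_posRoots_le_two_mul_of_negSemidef_pivot`, seat val-sym-mdr-p1 g6), now at every size.
* **`wNsd_le`**: a W-pencil (`…WLawDefs`: `X^e J + X^{d₁} P₁ + X^{d₂} P₂ + X^{d₃} Q`, here with NO ordering of the exponents) with `J ⪯ 0`
  has `Z₊ ≤ 2·∑_{j odd ≤ min r n} C(n − j + 2, 2)`; **`wNsd_three_le_fourteen(')`**: at `n = 3` this is `14` — the tree's ten-root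
  `3 × 3` witness `…WLawThreeWitness` HAS a negative-definite pivot, so the definite sub-column of `w(3)` lies in `[10, 14]` (the full row is
  `10 ≤ w(3) ≤ 18`, `…WLawNotSharp`; at `n = 2` both the definite sub-column and the row are `6`).
Nothing here bears on `MatrixDescartes` in its window, on `stub_twoSided`, on `DoorA26` / `DoorA34`, on the cell's registers, or on `VP ≠ VNP`.

[folklore] Cauchy–Binet (tree `Pivot.GramExpansion.coeff_det_gramPencil`), the Gram form `Pivot.IndexGraded.pencil_eq_gram`, the
negative-support budget `Pivot.TwoDescartes.card_posRoots_le_two_mul_card`.  No definitions, no named facts.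
-/

-- `Summit.ValiantsHypothesis.ValiantsHypothesis.…` repeats a component by the single-conjunct
-- summit layout, which the `dupNamespace` linter flags; the name is mandated.
set_option linter.dupNamespace false

namespace Summit.ValiantsHypothesis.ValiantsHypothesis.Theorems.LacunarySymmetroidMatrixDescartes.Pivot

open Polynomial Matrix Finset IndexGraded
open scoped BigOperators MatrixOrder

namespace DefiniteGraded

variable {m K q : ℕ}

/-- **THE DEFINITE-PIVOT GRADED LAW AT EVERY SIZE.**  For `J = −W Wᵀ ⪯ 0` (`W` real `m × r`) and PSD letters `Pₖ`:
`Z₊ ≤ 2 · ∑_{j odd, j ≤ min r m} C(K + m − j − 1, K − 1)` — the positive part `S₀` of the pivot is absent, so the odd levels are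
indexed by multisets of the `K` letters only.  (`m = 2`, `r ≤ 2`: `2K`, the tree's definite-pivot law.) [folklore] -/
theorem negSemidef_pivot_graded (e : ℕ) (d : Fin K → ℕ) (W : Matrix (Fin m) (Fin q) ℝ) (P : Fin K → Matrix (Fin m) (Fin m) ℝ)
    (hP : ∀ k, (P k).PosSemidef) (hK : 0 < K) :
    pivotPosRoots e d (-(W * Wᵀ)) P
      ≤ 2 * ((Finset.range (min q m + 1)).filter (fun j => Odd j)).sum (fun j => Nat.choose (K + m - j - 1) (K - 1)) := by
  classical
  choose S hS using fun k => ResolventDescartes.exists_eq_mul_transpose (P k) (hP k)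
  have hS₀ : -(W * Wᵀ) + W * Wᵀ = (0 : Matrix (Fin m) (Fin m) ℝ) * (0 : Matrix (Fin m) (Fin m) ℝ)ᵀ := by simp
  unfold pivotPosRoots
  set σ := (Option (Fin K) × Fin m) ⊕ Fin q with hσ
  set ε : σ ≃ Fin (Fintype.card σ) := Fintype.equivFin σ with hε
  set sgσ : σ → ℝ := Sum.elim (fun _ => (1 : ℝ)) (fun _ => -1) with hsg
  set exσ : σ → ℕ := Sum.elim (fun oc => oc.1.elim e d) (fun _ => e) with hex
  rw [pencil_eq_gram e d (-(W * Wᵀ)) P W 0 S hS₀ hS ε]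
  -- the odd-level exponent set over the K letters only
  set T : Finset ℕ := ((Finset.range (min q m + 1)).filter (fun j => Odd j)).biUnion
      (fun j => (Finset.univ : Finset (Sym (Fin K) (m - j))).image
        (fun s : Sym (Fin K) (m - j) => j * e + ((s : Multiset (Fin K)).map d).sum)) with hT
  have hTcard : T.card ≤ ((Finset.range (min q m + 1)).filter (fun j => Odd j)).sum (fun j => Nat.choose (K + m - j - 1) (K - 1)) := by
    refine Finset.card_biUnion_le.trans (Finset.sum_le_sum fun j hj => ?_)
    calc _ ≤ (Finset.univ : Finset (Sym (Fin K) (m - j))).card := Finset.card_image_le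
      _ = Nat.choose (K + m - j - 1) (K - 1) := by
          rw [Finset.card_univ, Sym.card_sym_eq_choose, Fintype.card_fin]
          have hjm : j ≤ m := by have := Finset.mem_range.mp (Finset.mem_filter.mp hj).1; omega
          obtain ⟨K', rfl⟩ : ∃ K', K = K' + 1 := ⟨K - 1, by omega⟩
          rw [show K' + 1 + (m - j) - 1 = K' + (m - j) by omega, show K' + 1 + m - j - 1 = K' + (m - j) by omega,
            show K' + 1 - 1 = K' by omega]
          exact Nat.choose_symm_add.symm
  refine (TwoDescartes.card_posRoots_le_two_mul_card _ T fun n hn => ?_).trans (Nat.mul_le_mul_left 2 hTcard)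
  by_contra hnT
  refine absurd hn (not_lt.2 ?_)
  rw [GramExpansion.coeff_det_gramPencil]
  refine Finset.sum_nonneg fun t ht => ?_
  have htinj : Function.Injective t := (Finset.mem_filter.1 ht).2.injective
  split_ifs with hsum
  swap
  · exact le_rfl
  -- a selection through a column of `S₀ = 0` has a zero column
  by_cases hzero : ∃ a c, ε.symm (t a) = Sum.inl (none, c)
  · obtain ⟨a, c, hac⟩ := hzero
    have hdet : (Matrix.of fun i a' => (Sum.elim (fun oc : Option (Fin K) × Fin m => fun i => (oc.1.elim (0 : Matrix (Fin m) (Fin m) ℝ) S) i oc.2)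
        (fun c => fun i => W i c)) (ε.symm (t a')) i).det = 0 := by
      refine Matrix.det_eq_zero_of_column_eq_zero a fun i => ?_
      rw [Matrix.of_apply, hac]
      simp
    rw [hdet]; simp
  push Not at hzero
  set A : Finset (Fin m) := Finset.univ.filter (fun a => ∃ c, ε.symm (t a) = Sum.inr c) with hA
  have hsign : ∏ a, sgσ (ε.symm (t a)) = (-1 : ℝ) ^ A.card := by
    rw [← Finset.prod_filter_mul_prod_filter_not Finset.univ (fun a => ∃ c, ε.symm (t a) = Sum.inr c), ← hA]
    have h1 : ∏ a ∈ A, sgσ (ε.symm (t a)) = (-1 : ℝ) ^ A.card := by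
      rw [← Finset.prod_const]
      refine Finset.prod_congr rfl fun a ha => ?_
      obtain ⟨c, hc⟩ := (Finset.mem_filter.mp (hA ▸ ha)).2
      rw [hc, hsg, Sum.elim_inr]
    have h2 : ∏ a ∈ Finset.univ.filter (fun a => ¬ ∃ c, ε.symm (t a) = Sum.inr c), sgσ (ε.symm (t a)) = 1 := by
      refine Finset.prod_eq_one fun a ha => ?_
      have hno := (Finset.mem_filter.mp ha).2
      rcases hx : ε.symm (t a) with oc | c
      · rw [hsg, Sum.elim_inl]
      · exact absurd ⟨c, hx⟩ hno
    rw [h1, h2, mul_one]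
  by_cases hpar : Even A.card
  · change 0 ≤ (∏ a, sgσ (ε.symm (t a))) * _
    rw [hsign, hpar.neg_one_pow, one_mul]
    exact sq_nonneg _
  · exfalso
    have hodd : Odd A.card := Nat.not_even_iff_odd.mp hpar
    -- the other rows select genuine letter columns `some k`
    have hother : ∀ a, a ∉ A → ∃ kc : Fin K × Fin m, ε.symm (t a) = Sum.inl (some kc.1, kc.2) := by
      intro a ha
      rcases hx : ε.symm (t a) with oc | c
      · rcases oc with ⟨o, c⟩
        rcases o with _ | k
        · exact absurd hx (hzero a c)
        · exact ⟨(k, c), rfl⟩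
      · exact absurd (Finset.mem_filter.mpr ⟨Finset.mem_univ _, ⟨c, hx⟩⟩) (hA ▸ ha)
    obtain ⟨a₀, -⟩ := Finset.card_pos.mp hodd.pos
    haveI : Nonempty (Fin K × Fin m) := ⟨(⟨0, hK⟩, a₀)⟩
    choose! kc hkc using hother
    set s : Multiset (Fin K) := (Finset.univ \ A).val.map (fun a => (kc a).1) with hs
    have hAq : A.card ≤ q := by
      rcases Nat.eq_zero_or_pos q with hq0 | hq0
      · subst hq0
        have : A = ∅ := by
          rw [Finset.eq_empty_iff_forall_notMem]
          intro a ha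
          obtain ⟨c, _⟩ := (Finset.mem_filter.mp (hA ▸ ha)).2
          exact Fin.elim0 c
        rw [this, Finset.card_empty]
      · have hinj : ∀ a b, ε.symm (t a) = ε.symm (t b) → a = b := fun a b h => htinj (ε.symm.injective h)
        let col : Fin m → Fin q := fun a => (ε.symm (t a)).elim (fun _ => ⟨0, hq0⟩) id
        have : A.card ≤ (Finset.univ : Finset (Fin q)).card := by
          refine Finset.card_le_card_of_injOn col (fun _ _ => Finset.mem_univ _) ?_
          intro a ha b hb hab
          obtain ⟨ca, hca⟩ := (Finset.mem_filter.mp (hA ▸ Finset.mem_coe.mp ha)).2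
          obtain ⟨cb, hcb⟩ := (Finset.mem_filter.mp (hA ▸ Finset.mem_coe.mp hb)).2
          have hc : ca = cb := by simpa [col, hca, hcb] using hab
          exact hinj a b (by rw [hca, hcb, hc])
        simpa using this
    have hscard : Multiset.card s = m - A.card := by
      rw [hs, Multiset.card_map, Finset.card_val, Finset.card_sdiff, Finset.inter_univ, Finset.card_univ, Fintype.card_fin]
    have hAm : A.card ≤ m := (Finset.card_le_univ A).trans (by rw [Fintype.card_fin])
    apply hnT
    rw [hT]
    refine Finset.mem_biUnion.mpr ⟨A.card, Finset.mem_filter.mpr ⟨Finset.mem_range.mpr ?_, hodd⟩, ?_⟩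
    · have := Nat.le_min.mpr ⟨hAq, hAm⟩; omega
    refine Finset.mem_image.mpr ⟨⟨s, hscard⟩, Finset.mem_univ _, ?_⟩
    rw [hsum, ← Finset.sum_filter_add_sum_filter_not Finset.univ (fun a => ∃ c, ε.symm (t a) = Sum.inr c), ← hA]
    have hneg : ∑ a ∈ A, exσ (ε.symm (t a)) = A.card * e := by
      rw [Finset.sum_const_nat fun a ha => ?_]
      obtain ⟨c, hc⟩ := (Finset.mem_filter.mp (hA ▸ ha)).2
      rw [hc, hex, Sum.elim_inr]
    have hset : Finset.univ.filter (fun a => ¬ ∃ c, ε.symm (t a) = Sum.inr c) = Finset.univ \ A := by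
      ext a; simp [hA]
    have hpos : ∑ a ∈ Finset.univ.filter (fun a => ¬ ∃ c, ε.symm (t a) = Sum.inr c), exσ (ε.symm (t a))
        = (s.map d).sum := by
      rw [hs, Multiset.map_map, Function.comp_def, ← Finset.sum_map_val, hset]
      refine Finset.sum_congr rfl fun a ha => ?_
      have ha' : a ∉ A := (Finset.mem_sdiff.mp ha).2
      rw [hkc a ha', hex, Sum.elim_inl]
      rfl
    change (A.card * e + (s.map d).sum) = _
    rw [hneg, hpos]

/-- **The four-letter column with a negative-semidefinite pivot** (every size `n`): a W-pencil
`X^e J + X^{d₁} P₁ + X^{d₂} P₂ + X^{d₃} Q` with `J ⪯ 0` (written `J = −W Wᵀ`, `W` real `n × r`) and `P₁, P₂, Q ⪰ 0` has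
`Z₊ ≤ 2 · ∑_{j odd, j ≤ min r n} C(n − j + 2, 2)` (no ordering of the exponents is needed). [folklore] -/
theorem wNsd_le {n r : ℕ} (e d₁ d₂ d₃ : ℕ) (W : Matrix (Fin n) (Fin r) ℝ) (P₁ P₂ Q : Matrix (Fin n) (Fin n) ℝ)
    (hP₁ : P₁.PosSemidef) (hP₂ : P₂.PosSemidef) (hQ : Q.PosSemidef) :
    ((Matrix.det (((X : ℝ[X]) ^ e) • (-(W * Wᵀ)).map Polynomial.C
        + ((X : ℝ[X]) ^ d₁) • P₁.map Polynomial.C + ((X : ℝ[X]) ^ d₂) • P₂.map Polynomial.C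
        + ((X : ℝ[X]) ^ d₃) • Q.map Polynomial.C)).roots.toFinset.filter (fun t => 0 < t)).card
      ≤ 2 * ((Finset.range (min r n + 1)).filter (fun j => Odd j)).sum (fun j => Nat.choose (n - j + 2) 2) := by
  have hP : ∀ k : Fin 3, ((![P₁, P₂, Q] : Fin 3 → Matrix (Fin n) (Fin n) ℝ) k).PosSemidef := by
    intro k; fin_cases k <;> assumption
  have h := negSemidef_pivot_graded e (![d₁, d₂, d₃] : Fin 3 → ℕ) W ![P₁, P₂, Q] hP (by norm_num)
  unfold pivotPosRoots at h
  have hsum : ((X : ℝ[X]) ^ e) • (-(W * Wᵀ)).map Polynomial.C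
        + ((X : ℝ[X]) ^ d₁) • P₁.map Polynomial.C + ((X : ℝ[X]) ^ d₂) • P₂.map Polynomial.C
        + ((X : ℝ[X]) ^ d₃) • Q.map Polynomial.C
      = ((X : ℝ[X]) ^ e) • (-(W * Wᵀ)).map Polynomial.C
        + ∑ k : Fin 3, ((X : ℝ[X]) ^ (![d₁, d₂, d₃] : Fin 3 → ℕ) k) •
          ((![P₁, P₂, Q] : Fin 3 → Matrix (Fin n) (Fin n) ℝ) k).map Polynomial.C := by
    rw [Fin.sum_univ_three]
    simp only [Matrix.cons_val_zero, Matrix.cons_val_one, Matrix.cons_val_two, Matrix.head_cons, Matrix.tail_cons]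
    abel
  rw [hsum]
  refine h.trans (Nat.mul_le_mul_left 2 (Finset.sum_le_sum fun j hj => ?_))
  have hjn : j ≤ n := by have := Finset.mem_range.mp (Finset.mem_filter.mp hj).1; omega
  rw [show 3 + n - j - 1 = n - j + 2 by omega]

/-- `n = 3`: a W-pencil of size `3` with `J ⪯ 0` has at most `14 = 2·(C(4,2) + C(2,2))` distinct positive determinant zeros
(the tree's ten-root witness `…WLawThreeWitness` has a negative-definite pivot: the definite sub-column of `w(3)` lies in `[10, 14]`;
the full row is `10 ≤ w(3) ≤ 18`, `…WLawNotSharp`). [folklore] -/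
theorem wNsd_three_le_fourteen {r : ℕ} (e d₁ d₂ d₃ : ℕ) (W : Matrix (Fin 3) (Fin r) ℝ) (P₁ P₂ Q : Matrix (Fin 3) (Fin 3) ℝ)
    (hP₁ : P₁.PosSemidef) (hP₂ : P₂.PosSemidef) (hQ : Q.PosSemidef) :
    ((Matrix.det (((X : ℝ[X]) ^ e) • (-(W * Wᵀ)).map Polynomial.C
        + ((X : ℝ[X]) ^ d₁) • P₁.map Polynomial.C + ((X : ℝ[X]) ^ d₂) • P₂.map Polynomial.C
        + ((X : ℝ[X]) ^ d₃) • Q.map Polynomial.C)).roots.toFinset.filter (fun t => 0 < t)).card ≤ 14 := by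
  refine (wNsd_le e d₁ d₂ d₃ W P₁ P₂ Q hP₁ hP₂ hQ).trans ?_
  -- the odd levels `j ≤ min r 3` are among `{1, 3}`: `C(4,2) + C(2,2) = 7`
  have hsub : (Finset.range (min r 3 + 1)).filter (fun j => Odd j) ⊆ (Finset.range 4).filter (fun j => Odd j) := by
    refine Finset.filter_subset_filter _ (Finset.range_subset_range.mpr ?_)
    omega
  refine (Nat.mul_le_mul_left 2 (Finset.sum_le_sum_of_subset hsub)).trans ?_
  rw [Finset.sum_filter, Finset.sum_range_succ, Finset.sum_range_succ, Finset.sum_range_succ, Finset.sum_range_succ,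
    Finset.sum_range_zero]
  simp [Nat.odd_iff, Nat.choose]

/-- The same with the pivot GIVEN as a negative-semidefinite symmetric matrix `J` (`−J ⪰ 0`): `n = 3 ⇒ Z₊ ≤ 14`. [folklore] -/
theorem wNsd_three_le_fourteen' (e d₁ d₂ d₃ : ℕ) (J P₁ P₂ Q : Matrix (Fin 3) (Fin 3) ℝ) (hJ : (-J).PosSemidef)
    (hP₁ : P₁.PosSemidef) (hP₂ : P₂.PosSemidef) (hQ : Q.PosSemidef) :
    ((Matrix.det (((X : ℝ[X]) ^ e) • J.map Polynomial.C
        + ((X : ℝ[X]) ^ d₁) • P₁.map Polynomial.C + ((X : ℝ[X]) ^ d₂) • P₂.map Polynomial.C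
        + ((X : ℝ[X]) ^ d₃) • Q.map Polynomial.C)).roots.toFinset.filter (fun t => 0 < t)).card ≤ 14 := by
  obtain ⟨W, hW⟩ := ResolventDescartes.exists_eq_mul_transpose (-J) hJ
  have hJ' : J = -(W * Wᵀ) := by rw [← hW, neg_neg]
  rw [hJ']
  exact wNsd_three_le_fourteen e d₁ d₂ d₃ W P₁ P₂ Q hP₁ hP₂ hQ

end DefiniteGraded

end Summit.ValiantsHypothesis.ValiantsHypothesis.Theorems.LacunarySymmetroidMatrixDescartes.Pivot
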